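import Summits.BirchSwinnertonDyer.BirchSwinnertonDyer.Theorems.AdditiveKolyvaginRoadVisibleCoreBricks
import Summits.BirchSwinnertonDyer.BirchSwinnertonDyer.Theorems.AdditiveKolyvaginRoadEigen
import Literature.NumberTheory.EllipticCurves.HeegnerPointsKolyvaginSelmerProofs
import Summits.BirchSwinnertonDyer.BirchSwinnertonDyer.Theorems.ClassRecordThreeShimuraKolyvaginImageInputs
import Literature.NumberTheory.Automorphic.BrandtGrossPoints
import Literature.NumberTheory.Automorphic.BrandtEigenLine
import Literature.NumberTheory.EllipticCurves.ZhangLevelRaisedKolyvaginData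
import HarnessLib

/-!
# Crux `AnticyclotomicEisensteinDivisibility` (item stmt-BirchSwinnertonDyer-20727, route `SignedBaseChange`) —
# crux-idea «selwalk» (ideator seat bsd-idea-5 g22, lens «transfer»; publish-only sketch REV 3, W-79: registered on nothing)
# REV 3 (g30) = REV 2 with ONE token changed in every text: the Gross period is the WEIGHTED class sum
# `Brandt.toricPeriod S.O ψ I (fun i ↦ (Brandt.weight S.O i : ZMod p) * φ i)` (= Σ_𝔞 w(x_𝔞) φ(x_𝔞), the tree's `mulVec` = divisor convention for
# `Brandt.eigenSpace … (Brandt.matrix S.O) …` kept), per the LEAD's finding F6 (`Lines/admdef-lead-g20.md`, witness (N⁺,N⁻) = (1,11), K = ℚ(√−15):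
# unweighted orbit sum 0, weighted 1) and its skeleton v14/v15 (a971fa4d377eafea) texts; `DefiniteAnchorAt` and both plugs now read byte-identically
# to v15's `DefiniteToricNVTwoMult/LeOneMult` conclusions.  No proof changed (the period is an atom in every proof here).

## (P2) of the LEAD's port chain — the SELMER-KILLING WALK TO A DEFINITE VERTEX — is ALREADY KERNEL in the sibling cell
## `AdditiveKolyvaginRoad` (cruxes 20132 ∕ 21396); this file TRANSFERS it to cell β of line `admdef` v6 and composes it, with
## the two remaining inputs as named Props, into the consequent of v6's research stubs `DefiniteToricNVTwoMult/LeOneMult` ([NV″]) VERBATIM.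

HONEST CLASS: PORT ∕ TRANSFER (no new mechanism).  The LEAD memo `Lines/admdef-lead-g16.md` §3/§6 splits [NV″] («∃ odd admissible level
`s` and a mod-`p` Brandt eigenvector with E's eigenvalues on the definite quaternion algebra of discriminant `∏ s` whose toric period is
non-zero») into (P2) «W. Zhang's Thm 9.1 induction run to a definite vertex» + (P3) «anchor at the definite vertex» and books (P2) as «a
hand-sized PORT once (P3) is typed».  Tree reading (this seat, 2026-08-29): the cell `pub/bsd-wall` AKR (lead `bsd-wall-akr-p1`, width `p2x`)
has (P2) IN KERNEL at Bertolini–Darmon admissible primes for a general prime `p ≥ 5`: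

* the canonical level-raised eigen-Selmer spaces `Sel_n^μ ⊂ H¹(K, E[p])` — `AdditiveKoly.levelSelmerSubgroupP ∕ SelQP` (Kummer off `n`, TORIC
  at the places above `q ∈ n`, `μ`-eigen for complex conjugation `c`; `Theorems/AdditiveKolyvaginRoadLevelDefs.lean`);
* the (A1) RANK-LOWERING reduction `AdditiveKoly.selQP_rankLowering_of_localGlobal` ((Cheb)+(Equiv)+(Line)+(Trans)+(Iso) ⟹ W. Zhang Prop. 5.4:
  `Sel_{n∪q}^μ ≤ Sel_n^μ` of codimension one, `Sel_{n∪q}^{−μ} = Sel_n^{−μ}`; `…RankLoweringReduction.lean`) with the four local inputs PROVED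
  WITHOUT any hypothesis relating `p` and `N_E`: `localEquiv_of_admQ` (`[K:ℚ] = 2`, `c ≠ 1`), `localLine_of_admQ` (`[K:ℚ] = 2`),
  `localTrans_of_admQ` (—), `hiso_of_admQ` (`K` imaginary quadratic; Poitou–Tate isotropy, kernel);
* (Cheb) = W. Zhang Lemma 7.3 ∕ Bertolini–Darmon Thm. 3.2 PROVED as `AdditiveKoly.Cheb.exists_admissible_loc_ne_zero` ∕
  `localCheb_of_admQ_of_dvd` — under `p ∣ N_E` (resp. `Addv W p`);
* the DESCENT TO A ZERO VERTEX `AdditiveKoly.exists_zero_vertex_above` (`…VisibleCoreBricks.lean` §3): above every level `n` a level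
  `n' ⊇ n` with `Sel_{n'}^± = 0` and `#n' = #n + dim Sel_n⁺ + dim Sel_n⁻`.

THE DICTIONARY (one entry).  The ONLY use of `p ∣ N_E` in the (Cheb) chain is `AdditiveKolyvaginRoadChebTarget.exists_prime_dvd_discr_not_dvd`
(l.119–129: a prime `q₀ ∣ d_K` with `q₀ ∤ p N_E` — Gross's disjointness prime — obtained from «`p` splits in `K`» ⟸ Heegner + `p ∣ N_E`),
consumed once at l.233 of `exists_admissible_target`, itself consumed once at l.99 of `Cheb.exists_admissible_loc_ne_zero`.  On cell β
(`p ∤ N` good supersingular) the replacement input is «`p` SPLIT in `K`» — which IS a binder of v6's [NV″] stubs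
(`((Ideal.span {p}).primesOver (𝓞 K)).ncard = 2`): §1 below PROVES the replacement statement (`exists_prime_dvd_discr_not_dvd_of_split`).
What remains for HANDS (a Theorems generalisation, not new mathematics): thread `hsp` in place of `hpN` through those two AKR theorems
(≈ 450 proof lines otherwise unchanged) — then `LocalChebAt` (§2) holds on cell β in kernel and the (P2) half of [NV″] is kernel by §4–§5.

WHAT IS PROVED HERE (0 `sorry`; nothing about BSD, the crux, [NV″] or (P3) is asserted):
* §1 `exists_prime_dvd_discr_not_dvd_of_split` — the dictionary entry (shape of AKR's `exists_prime_dvd_discr_not_dvd` with `p ∣ N_E` ↦ `p` split).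
* §2 the three inputs of [NV″] on cell β as Props in the AKR currency: `LocalChebAt` ((Cheb), the binder shape of
  `selQP_rankLowering_of_localGlobal`; PRINT: Zha14 Lemma 7.3 ∕ BD05 Thm. 3.2; KERNEL at `p ∣ N_E` — §3), `OddBottomDim` (the bottom
  `p`-Selmer dimension is odd; PRINT: `p`-parity for `E/ℚ` and `E^K/ℚ` (Dokchitser–Dokchitser 2010 Thm. 1.4 ∕ Nekovář) + Cassels–Tate
  + the Heegner sign `w(E/K) = −1`), `DefiniteAnchorAt` (= (P3): an odd ZERO vertex carries a mod-`p` Brandt eigenvector for `a_•(E)` with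
  non-zero toric period — Gross–Parson identification + rank-0 converse for the level-raised form (Wan 2016 Thm. 1.4 ∕ Kim–Ota 2023) + Gross's
  formula mod `℘` + Jacquet–Langlands mod `p`; the RESEARCH residue, exactly as the LEAD books it).
* §3 `localChebAt_of_dvd` — (Cheb) is the tree's theorem at `p ∣ N_E` (sanity of the Prop's shape; the sibling's solved instance).
* §4 ON ANY FRAME (`K` imaginary quadratic, `c ≠ 1`, `p` an odd prime): `selQP_rankLowering_of_localChebAt` ((A1) from (Cheb) alone, by the
  AKR reduction + the four kernel local inputs), `exists_zero_vertex_above_of_localChebAt` (descent), `exists_oddZeroVertex` ((Cheb) + odd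
  bottom dimension ⟹ an ODD-cardinality admissible level with `Sel^± = 0`, of cardinality `dim Sel⁺ + dim Sel⁻`).
* §5 `definiteToricNV_of_selwalk` — `LocalChebAt → OddBottomDim → DefiniteAnchorAt → ` the consequent of `DefiniteToricNVTwoMult` ∕
  `DefiniteToricNVLeOneMult` (v6 `Lines/admdef.lean` ll.500–506) VERBATIM; its `c`-FREE plug form `definiteToricNV_of_selwalk_of_oddSelmerDim`
  ((Cheb), (Anch) for every `c ≠ 1` + the literal «`dim_𝔽p Sel_p(E/K)` odd» `OddSelmerDim`, bridged to the eigen form by the AKR KERNEL identity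
  `finrank_selmer_eq_finrank_selQP_add`, §2 `oddBottomDim_of_oddSelmerDim`); and `zeroVertex_kernel_at_dvd` — at `p ∣ N_E` frames the walk is
  kernel outright (the sibling's case, recorded as the transfer's source).

NOT HERE: no `instance`, no notation, no named fact, no import of crux workfiles (W-79); the `ZMod p`-structure of `H¹(K, E[p])` is an
instance BINDER as in every AKR file (discharged by `AddCommGroup.zmodModule` at the call site).  BSD is not proved by any of this.

References: [cite: WZhang2014, Lemma 5.3, Prop. 5.4, Lemma 7.3, Thm. 9.1 (proof, pp. 240–242)] [cite: BertoliniDarmon2005, Thm. 3.2, Lemma 2.6,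
§2.2–§2.3] [cite: CastellaEtAl2025, §7.4 (repeated application of the argument of Zha14 Thm. 9.1)] [cite: GrossLMS1991, §9]
[cite: DokchitserDokchitser2010, Thm. 1.4] [cite: Gross1987, §§3–4, Prop. 10.3] [cite: arXiv:1607.07729 (X. Wan 2016), Thm. 1.4].
-/

-- D-0017: single-problem summit, the namespace repeats the problem name by design.
set_option linter.dupNamespace false
set_option autoImplicit false

noncomputable section

open scoped Classical NumberField

namespace Summit.BirchSwinnertonDyer.BirchSwinnertonDyer.Cruxes.AnticyclotomicEisensteinDivisibility.Selwalk

open WeierstrassCurve NumberField IsDedekindDomain Field Module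
  Literature.NumberTheory.EllipticCurves Literature.NumberTheory.GaloisRepresentations Literature.NumberTheory.Automorphic
  Summit.BirchSwinnertonDyer.BirchSwinnertonDyer.Theorems Summit.BirchSwinnertonDyer.BirchSwinnertonDyer.Theorems.AdditiveKoly

variable (W : WeierstrassCurve ℚ) (K : Type) [Field K] [NumberField K] (p : ℕ) [W.IsElliptic] [W.IsGloballyMinimal] [Fact p.Prime]

/-! ## §1 The dictionary entry: Gross's disjointness prime from «`p` split in `K`» instead of «`p ∣ N_E`» -/

omit [W.IsElliptic] [W.IsGloballyMinimal] [Fact p.Prime] in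
/-- **A ramified prime away from `p N_E`, from `p` SPLIT** (the statement of `AdditiveKoly…ChebTarget.exists_prime_dvd_discr_not_dvd` with its
hypothesis `p ∣ N_E` replaced by the cell-β binder «`p` splits in `K`»): for `K` quadratic, `N_E` Heegner in `K` and `p` split, some prime
`q ∣ d_K` divides neither `N_E` nor `p` (split primes are unramified).  [cite: GrossLMS1991, §9 (PDF p. 227)] -/
theorem exists_prime_dvd_discr_not_dvd_of_split (hK : IsImaginaryQuadratic K) (hp : p.Prime)
    (hsp : ((Ideal.span {(p : ℤ)}).primesOver (𝓞 K)).ncard = 2) (hH : SatisfiesHeegnerHypothesis (W.conductorNorm ℤ) K) :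
    ∃ q : ℕ, q.Prime ∧ (q : ℤ) ∣ NumberField.discr K ∧ ¬ q ∣ W.conductorNorm ℤ ∧ ¬ (q : ℤ) ∣ ((p : ℕ) : ℤ) := by
  obtain ⟨q, hq, hqd, hqN⟩ := ShimuraKolyvaginImageInputs.exists_prime_dvd_discr_not_dvd K hK.1 (N := p * W.conductorNorm ℤ) ∅
    (fun _ h ↦ absurd h (Finset.notMem_empty _))
    (fun ℓ hℓ hℓN _ ↦ by
      rcases (Nat.Prime.dvd_mul hℓ).mp hℓN with h | h
      · obtain rfl : ℓ = p := (Nat.prime_dvd_prime_iff_eq hℓ hp).mp h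
        exact hsp
      · exact hH ℓ hℓ h)
  refine ⟨q, hq, hqd, fun h ↦ hqN (Dvd.dvd.mul_left h p), fun h ↦ hqN ?_⟩
  have h' : q ∣ p := by exact_mod_cast h
  exact Dvd.dvd.mul_right h' _

/-! ## §2 The three inputs of [NV″] on cell β, as Props in the AKR currency -/

section Inputs

variable (c : K ≃ₐ[ℚ] K) [Module (ZMod p) (Vp W K p)]

/-- **(Cheb) — Čebotarev with the sign at Bertolini–Darmon admissible primes** (W. Zhang 2014 Lemma 7.3 ∕ Bertolini–Darmon 2005 Thm. 3.2), in
the binder shape of `AdditiveKoly.selQP_rankLowering_of_localGlobal`: every non-zero class of `Sel_n^μ` is detected by its localisation at the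
place of some NEW admissible prime.  KERNEL at `p ∣ N_E` ∕ `Addv W p` (`localCheb_of_admQ_of_dvd` ∕ `localCheb_of_admQ`); on cell β (`p`
split) it is the same proof with §1 in place of `exists_prime_dvd_discr_not_dvd` (hands).  [cite: WZhang2014, Lemma 7.3]
[cite: BertoliniDarmon2005, Thm. 3.2] -/
def LocalChebAt : Prop :=
  ∀ (n : Finset (AdmQ W K p)) (μ : Bool) (x : Vp W K p), x ∈ SelQP W K p c n μ → x ≠ 0 →
    ∃ q : AdmQ W K p, q ∉ n ∧ ∃ v : HeightOneSpectrum (𝓞 K),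
      ((q : ℕ) : 𝓞 K) ∈ v.asIdeal ∧ (W.baseChange K).torsionLocMap (v.adicCompletion K) ((p ^ 1 : ℕ) : ℤ) x ≠ 0

/-- **(Par) — the bottom `p`-Selmer dimension is ODD**: `dim_𝔽p Sel_p(E/K)⁺ + dim_𝔽p Sel_p(E/K)⁻` (the two `c`-eigenparts of the level-`∅`
space, i.e. of `Sel_p(E/K) ⊂ H¹(K, E[p])`) is odd.  PRINT on the frame of the crux (`ρ̄_{E,p}` onto so `E(K)[p] = 0`; `K` imaginary quadratic,
Heegner, so `w(E/K) = −1`): `dim Sel_p = corank Sel_{p^∞} + dim (Ш/div)[p]`, the second term EVEN (Cassels–Tate alternating), the first of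
parity `w(E/ℚ)·w(E^K/ℚ) = w(E/K) = −1` by `p`-parity over `ℚ` twice.  [cite: DokchitserDokchitser2010, Thm. 1.4] [cite: WZhang2014, Thm. 9.2] -/
def OddBottomDim : Prop :=
  Odd (finrank (ZMod p) (SelQP W K p c ∅ true) + finrank (ZMod p) (SelQP W K p c ∅ false))

/-- **(Par), `c`-free literal form — `dim_𝔽p Sel_p(E/K)` is ODD**: the `ZMod p`-rank of the whole `p`-Selmer group
`Sel_p(E/K) ⊂ H¹(K, E[p])` (`WeierstrassCurve.selmerGroup`) is odd.  This is the statement the PRINT port delivers on the crux frame (`E(K)[p] = 0`,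
`w(E/K) = −1`): `dim Sel_p = rk E(K) + dim Ш[p] = corank Sel_{p^∞} + dim (Ш/div)[p]`, Cassels–Tate makes the last term even, and `p`-parity over `ℚ` for
`E` and `E^K` gives `corank ≡ ord_{s=1} parity = 1 (mod 2)`.  [cite: DokchitserDokchitser2010, Thm. 1.4] [cite: WZhang2014, Thm. 9.2] -/
def OddSelmerDim : Prop :=
  Odd (finrank (ZMod p) (AddSubgroup.toZModSubmodule p (selmerGroup (W.baseChange K) ((p ^ 1 : ℕ) : ℤ))))

/-- **`c`-free (Par) ⟹ eigen (Par)** by the AKR cell's KERNEL bottom-level rank identity `AdditiveKoly.finrank_selmer_eq_finrank_selQP_add`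
(`dim Sel_p(E/K) = dim Sel_∅⁺ + dim Sel_∅⁻` for `p` odd, `K` imaginary quadratic; eigen-decomposition `x = u(x + cx) + u(x − cx)`, `2u ≡ 1`).
[cite: WZhang2014, §5 (5.1)] [cite: GrossParson, Lemma 9] -/
theorem oddBottomDim_of_oddSelmerDim (hp2 : p ≠ 2) (hK : IsImaginaryQuadratic K) (hodd : OddSelmerDim W K p) :
    OddBottomDim W K p c := by
  unfold OddBottomDim
  rw [← finrank_selmer_eq_finrank_selQP_add W K p hp2 hK c (Summit.BirchSwinnertonDyer.Rank1Residual.X11b.Three.Koly.Method2.algEquiv_mul_self_eq_one K hK c)]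
  exact hodd

/-- **(Anch) = (P3) — the DEFINITE ANCHOR at a zero vertex**, in the currency of v6's [NV″]: at every ODD admissible level `n` with
`Sel_n^+ = Sel_n^− = 0` there are a definite setup `S` of discriminant `∏ n` and Eichler level `N`, an optimal embedding `ψ : K → D`, a Gross
point `I` and a mod-`p` Brandt eigenvector `φ` for the eigenvalues `a_ℓ(E)` whose toric period is non-zero.  This is the RESEARCH residue of
[NV″] (LEAD memo §3/§6): Gross–Parson identification `Sel_n(E[p]) = Sel_℘(A_{g_n}/K)[℘]` (Zha14 Thm. 5.2), the rank-0 `℘`-converse for the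
level-raised newform `g_n` at a non-ordinary `℘` (Wan 2016 Thm. 1.4 ∕ Kim–Ota 2023), Gross's special-value formula mod `℘` and Jacquet–Langlands
mod `p` (multiplicity one at the non-Eisenstein `𝔪`).  NOT asserted.  [cite: WZhang2014, Thm. 5.2, Thm. 7.2] [cite: arXiv:1607.07729 (X. Wan 2016), Thm. 1.4]
[cite: Gross1987, Prop. 10.3, §11] [cite: CastellaEtAl2025, §7.4] -/
def DefiniteAnchorAt (N : ℕ) : Prop :=
  ∀ n : Finset (AdmQ W K p), Odd n.card → (∀ μ : Bool, SelQP W K p c n μ = ⊥) →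
    ∃ (S : Brandt.XiSetup N (∏ q ∈ n.image Subtype.val, q)) (ψ : K →ₐ[ℚ] S.D) (I : Submodule ℤ S.D)
      (φ : Brandt.ClassSet S.O → ZMod p),
      Brandt.IsGrossPoint S.O ψ I ∧
      (letI : Fintype (Brandt.ClassSet S.O) := Fintype.ofFinite _
       φ ∈ Brandt.eigenSpace (ZMod p) (N * ∏ q ∈ n.image Subtype.val, q) (Brandt.matrix S.O) (fun ℓ ↦ W.frobeniusTrace ℓ)) ∧
      Brandt.toricPeriod S.O ψ I (fun i ↦ (Brandt.weight S.O i : ZMod p) * φ i) ≠ 0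

end Inputs

/-! ## §3 (Cheb) at `p ∣ N_E` is the tree's theorem — the sibling's solved instance of the one transferred input -/

/-- **(Cheb) in kernel at `p ∣ N_E`** (`AdditiveKoly.localCheb_of_admQ_of_dvd`, cell AKR): the Prop `LocalChebAt` in the sibling setting.
[cite: WZhang2014, Lemma 7.3] [cite: BertoliniDarmon2005, Thm. 3.2] -/
theorem localChebAt_of_dvd (h5 : 5 ≤ p) (hpN : p ∣ W.conductorNorm ℤ) (hsurj : W.HasSurjectiveModNGaloisRep p)
    (hK : IsImaginaryQuadratic K) (hH : SatisfiesHeegnerHypothesis (W.conductorNorm ℤ) K)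
    {c : K ≃ₐ[ℚ] K} (hc1 : c ≠ 1) [Module (ZMod p) (Vp W K p)] : LocalChebAt W K p c :=
  localCheb_of_admQ_of_dvd W K p h5 hpN hsurj hK hH hc1

/-! ## §4 KERNEL on any frame: rank lowering, descent to a zero vertex, an ODD zero vertex -/

section Walk

variable {W K p}

/-- **(A1) RANK LOWERING from (Cheb) alone**, on ANY frame with `K` imaginary quadratic, `c ≠ 1`, `p` odd (W. Zhang Prop. 5.4 + (9.1)–(9.2)):
the AKR reduction `selQP_rankLowering_of_localGlobal` fed with (Cheb) and the four KERNEL local inputs `localEquiv_of_admQ`, `localLine_of_admQ`,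
`localTrans_of_admQ`, `hiso_of_admQ` — none of which mentions `N_E`.  [cite: WZhang2014, Prop. 5.4, §9 (9.1)–(9.2)]
[cite: BertoliniDarmon2005, Lemma 2.6] -/
theorem selQP_rankLowering_of_localChebAt (hK : IsImaginaryQuadratic K) (hp2 : p ≠ 2) {c : K ≃ₐ[ℚ] K} (hc1 : c ≠ 1)
    [Module (ZMod p) (Vp W K p)] (hcheb : LocalChebAt W K p c) :
    ∀ (n : Finset (AdmQ W K p)) (μ : Bool) (x : Vp W K p),
      x ∈ SelQP W K p c n μ → x ≠ 0 →
      ∃ q : AdmQ W K p, q ∉ n ∧ x ∉ SelQP W K p c (insert q n) μ ∧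
        SelQP W K p c (insert q n) μ ≤ SelQP W K p c n μ ∧
        finrank (ZMod p) (SelQP W K p c (insert q n) μ) + 1 = finrank (ZMod p) (SelQP W K p c n μ) ∧
        SelQP W K p c (insert q n) (!μ) = SelQP W K p c n (!μ) :=
  selQP_rankLowering_of_localGlobal W K p c ((Fact.out : p.Prime).odd_of_ne_two hp2) hcheb
    (localEquiv_of_admQ W K p hK.1 hc1) (localLine_of_admQ W K p hK.1) (localTrans_of_admQ W K p) (hiso_of_admQ W K p c hK)

/-- **DESCENT TO A ZERO VERTEX from (Cheb)**: above every level `n` there is `n' ⊇ n` with `Sel_{n'}^± = 0` and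
`#n' = #n + dim Sel_n⁺ + dim Sel_n⁻` (one new admissible prime per dimension; the proof of `AdditiveKoly.exists_zero_vertex_above` verbatim,
with (A1) from (Cheb)).  [cite: WZhang2014, Thm. 9.1 (proof)] [cite: CastellaEtAl2025, §7.4] -/
theorem exists_zero_vertex_above_of_localChebAt (hK : IsImaginaryQuadratic K) (hp2 : p ≠ 2) {c : K ≃ₐ[ℚ] K} (hc1 : c ≠ 1)
    [Module (ZMod p) (Vp W K p)] (hcheb : LocalChebAt W K p c) (n : Finset (AdmQ W K p)) :
    ∃ n' : Finset (AdmQ W K p), n ⊆ n' ∧ (∀ μ : Bool, SelQP W K p c n' μ = ⊥) ∧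
      n'.card = n.card + (finrank (ZMod p) (SelQP W K p c n true) + finrank (ZMod p) (SelQP W K p c n false)) := by
  suffices h : ∀ (r : ℕ) (n : Finset (AdmQ W K p)),
      finrank (ZMod p) (SelQP W K p c n true) + finrank (ZMod p) (SelQP W K p c n false) = r →
      ∃ n' : Finset (AdmQ W K p), n ⊆ n' ∧ (∀ μ : Bool, SelQP W K p c n' μ = ⊥) ∧ n'.card = n.card + r from
    h _ n rfl
  intro r
  induction r with
  | zero =>
    intro n hn
    refine ⟨n, subset_rfl, fun μ ↦ ?_, by rw [add_zero]⟩
    haveI := finiteDimensional_selQP W K p c n μ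
    have h0 : finrank (ZMod p) (SelQP W K p c n μ) = 0 := by cases μ <;> omega
    exact Submodule.finrank_eq_zero.mp h0
  | succ r ih =>
    intro n hn
    obtain ⟨μ, hμ⟩ : ∃ μ : Bool, 0 < finrank (ZMod p) (SelQP W K p c n μ) := by
      by_cases h : 0 < finrank (ZMod p) (SelQP W K p c n true)
      · exact ⟨true, h⟩
      · exact ⟨false, by omega⟩
    haveI := finiteDimensional_selQP W K p c n μ
    obtain ⟨x, hx, hx0⟩ : ∃ x ∈ SelQP W K p c n μ, x ≠ 0 := by
      by_contra hall
      push Not at hall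
      have : SelQP W K p c n μ = ⊥ := (Submodule.eq_bot_iff _).mpr hall
      rw [this, finrank_bot] at hμ
      exact lt_irrefl 0 hμ
    obtain ⟨q, hqn, -, -, hfr, heq⟩ := selQP_rankLowering_of_localChebAt hK hp2 hc1 hcheb n μ x hx hx0
    have htot : finrank (ZMod p) (SelQP W K p c (insert q n) true) +
        finrank (ZMod p) (SelQP W K p c (insert q n) false) = r := by
      cases μ
      · have heq' : SelQP W K p c (insert q n) true = SelQP W K p c n true := heq
        rw [heq']
        omega
      · have heq' : SelQP W K p c (insert q n) false = SelQP W K p c n false := heq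
        rw [heq']
        omega
    obtain ⟨n', hsub, hzero, hcard⟩ := ih (insert q n) htot
    refine ⟨n', (Finset.subset_insert q n).trans hsub, hzero, ?_⟩
    rw [hcard, Finset.card_insert_of_notMem hqn]
    omega

/-- **AN ODD ZERO VERTEX** (the (P2) half of [NV″]): from (Cheb) and an odd bottom dimension there is an admissible level `n` of ODD
cardinality — exactly `dim Sel⁺ + dim Sel⁻` new admissible primes above `∅` — with `Sel_n^+ = Sel_n^− = 0` (CHKLL25 §7.4: «by a repeated
application of the argument in the proof of [Zha14, Thm 9.1] … there exists m = q₁⋯q_r ∈ 𝒩^def …»).  [cite: CastellaEtAl2025, §7.4]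
[cite: WZhang2014, Thm. 9.1 (proof)] -/
theorem exists_oddZeroVertex (hK : IsImaginaryQuadratic K) (hp2 : p ≠ 2) {c : K ≃ₐ[ℚ] K} (hc1 : c ≠ 1)
    [Module (ZMod p) (Vp W K p)] (hcheb : LocalChebAt W K p c) (hodd : OddBottomDim W K p c) :
    ∃ n : Finset (AdmQ W K p), Odd n.card ∧ (∀ μ : Bool, SelQP W K p c n μ = ⊥) ∧
      n.card = finrank (ZMod p) (SelQP W K p c ∅ true) + finrank (ZMod p) (SelQP W K p c ∅ false) := by
  obtain ⟨n, -, hzero, hcard⟩ := exists_zero_vertex_above_of_localChebAt hK hp2 hc1 hcheb ∅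
  rw [Finset.card_empty, zero_add] at hcard
  exact ⟨n, hcard ▸ hodd, hzero, hcard⟩

end Walk

/-! ## §5 The composition to [NV″]'s consequent VERBATIM (v6 `Lines/admdef.lean` ll.500–506), and the sibling's kernel case -/

section Assembly

variable {W K p}

omit [NumberField K] [W.IsElliptic] [Fact p.Prime] in
/-- A finite set of admissible primes, read in `ℕ`, is a Zhang admissible level. [cite: WZhang2014, Notations (xiv)] -/
theorem isZhangAdmissibleLevel_image_val (n : Finset (AdmQ W K p)) :
    IsZhangAdmissibleLevel (W.conductorNorm ℤ) K (fun ℓ ↦ W.frobeniusTrace ℓ) p (n.image Subtype.val) := by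
  intro q hq
  obtain ⟨q', -, rfl⟩ := Finset.mem_image.mp hq
  exact q'.2

omit [NumberField K] [W.IsElliptic] [Fact p.Prime] in
/-- Reading a level in `ℕ` does not change its cardinality. [folklore] -/
theorem card_image_val (n : Finset (AdmQ W K p)) : (n.image Subtype.val).card = n.card :=
  Finset.card_image_of_injective _ Subtype.val_injective

/-- **[NV″] on cell β from (Cheb) + (Par) + (Anch)** — the consequent of v6's `DefiniteToricNVTwoMult` ∕ `DefiniteToricNVLeOneMult` VERBATIM
(«∃ s Zhang-admissible of odd cardinality, ∃ S ψ I φ, Gross point ∧ mod-p Brandt eigenvector for a_•(E) ∧ toric period ≠ 0»), for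
`(N : ℤ) = N_E` as in the stubs' binder list.  The walk (§4) supplies the odd zero vertex; (Anch) = (P3) supplies the Brandt data there.
Conditional on the three named Props; nothing is booked.  [cite: CastellaEtAl2025, §7.4] [cite: WZhang2014, Thm. 9.1, Thm. 7.2] -/
theorem definiteToricNV_of_selwalk {N : ℕ} (hN : (N : ℤ) = W.conductorNorm ℤ)
    (hK : IsImaginaryQuadratic K) (hp2 : p ≠ 2) {c : K ≃ₐ[ℚ] K} (hc1 : c ≠ 1) [Module (ZMod p) (Vp W K p)]
    (hcheb : LocalChebAt W K p c) (hodd : OddBottomDim W K p c) (hanch : DefiniteAnchorAt W K p c N) :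
    ∃ s : Finset ℕ, IsZhangAdmissibleLevel N K (fun ℓ ↦ W.frobeniusTrace ℓ) p s ∧ Odd s.card ∧
      ∃ (S : Brandt.XiSetup N (∏ q ∈ s, q)) (ψ : K →ₐ[ℚ] S.D) (I : Submodule ℤ S.D)
        (φ : Brandt.ClassSet S.O → ZMod p),
        Brandt.IsGrossPoint S.O ψ I ∧
        (letI : Fintype (Brandt.ClassSet S.O) := Fintype.ofFinite _
         φ ∈ Brandt.eigenSpace (ZMod p) (N * ∏ q ∈ s, q) (Brandt.matrix S.O) (fun ℓ ↦ W.frobeniusTrace ℓ)) ∧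
        Brandt.toricPeriod S.O ψ I (fun i ↦ (Brandt.weight S.O i : ZMod p) * φ i) ≠ 0 := by
  have hN' : N = W.conductorNorm ℤ := by exact_mod_cast hN
  obtain ⟨n, hodd', hzero, -⟩ := exists_oddZeroVertex hK hp2 hc1 hcheb hodd
  obtain ⟨S, ψ, I, φ, hGP, heig, hper⟩ := hanch n hodd' hzero
  refine ⟨n.image Subtype.val, ?_, ?_, S, ψ, I, φ, hGP, heig, hper⟩
  · rw [hN']; exact isZhangAdmissibleLevel_image_val n
  · rw [card_image_val]; exact hodd'

/-- **[NV″] on cell β, `c`-FREE form — the plug shape.**  Hypotheses: (Cheb) and (Anch) for every non-trivial automorphism `c` of `K` (there is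
exactly one: complex conjugation; `Literature…exists_conj_of_isImaginaryQuadratic`), and the literal parity statement `OddSelmerDim` («`dim_𝔽p Sel_p(E/K)`
odd»).  Conclusion: the consequent of v6's `DefiniteToricNVTwoMult` ∕ `DefiniteToricNVLeOneMult` VERBATIM — no `c`, no `SelQP` in it.  Conditional on the
named Props; nothing is booked.  [cite: CastellaEtAl2025, §7.4] [cite: WZhang2014, Thm. 9.1, Thm. 9.2] [cite: DokchitserDokchitser2010, Thm. 1.4] -/
theorem definiteToricNV_of_selwalk_of_oddSelmerDim {N : ℕ} (hN : (N : ℤ) = W.conductorNorm ℤ)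
    (hK : IsImaginaryQuadratic K) (hp2 : p ≠ 2) [Module (ZMod p) (Vp W K p)]
    (hcheb : ∀ c : K ≃ₐ[ℚ] K, c ≠ 1 → LocalChebAt W K p c) (hodd : OddSelmerDim W K p)
    (hanch : ∀ c : K ≃ₐ[ℚ] K, c ≠ 1 → DefiniteAnchorAt W K p c N) :
    ∃ s : Finset ℕ, IsZhangAdmissibleLevel N K (fun ℓ ↦ W.frobeniusTrace ℓ) p s ∧ Odd s.card ∧
      ∃ (S : Brandt.XiSetup N (∏ q ∈ s, q)) (ψ : K →ₐ[ℚ] S.D) (I : Submodule ℤ S.D)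
        (φ : Brandt.ClassSet S.O → ZMod p),
        Brandt.IsGrossPoint S.O ψ I ∧
        (letI : Fintype (Brandt.ClassSet S.O) := Fintype.ofFinite _
         φ ∈ Brandt.eigenSpace (ZMod p) (N * ∏ q ∈ s, q) (Brandt.matrix S.O) (fun ℓ ↦ W.frobeniusTrace ℓ)) ∧
        Brandt.toricPeriod S.O ψ I (fun i ↦ (Brandt.weight S.O i : ZMod p) * φ i) ≠ 0 := by
  obtain ⟨c, hc1, -⟩ := exists_conj_of_isImaginaryQuadratic (K := K) hK
  exact definiteToricNV_of_selwalk hN hK hp2 hc1 (hcheb c hc1) (oddBottomDim_of_oddSelmerDim W K p c hp2 hK hodd) (hanch c hc1)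

/-- **The sibling's case in kernel** — the source of the transfer: at a frame with `p ∣ N_E` (`p ≥ 5`, `ρ̄_{E,p}` onto, `K` imaginary quadratic
with the Heegner hypothesis, `c ≠ 1`) the walk to an odd zero vertex needs ONLY the odd bottom dimension (everything else is the AKR cell's
kernel).  [cite: WZhang2014, Lemma 7.3, Prop. 5.4, Thm. 9.1 (proof)] [cite: BertoliniDarmon2005, Thm. 3.2] -/
theorem zeroVertex_kernel_at_dvd (h5 : 5 ≤ p) (hpN : p ∣ W.conductorNorm ℤ) (hsurj : W.HasSurjectiveModNGaloisRep p)
    (hK : IsImaginaryQuadratic K) (hH : SatisfiesHeegnerHypothesis (W.conductorNorm ℤ) K)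
    {c : K ≃ₐ[ℚ] K} (hc1 : c ≠ 1) [Module (ZMod p) (Vp W K p)] (hodd : OddBottomDim W K p c) :
    ∃ n : Finset (AdmQ W K p), Odd n.card ∧ (∀ μ : Bool, SelQP W K p c n μ = ⊥) :=
  let ⟨n, h1, h2, _⟩ := exists_oddZeroVertex hK (by omega) hc1 (localChebAt_of_dvd W K p h5 hpN hsurj hK hH hc1) hodd
  ⟨n, h1, h2⟩

end Assembly

end Summit.BirchSwinnertonDyer.BirchSwinnertonDyer.Cruxes.AnticyclotomicEisensteinDivisibility.Selwalk

end
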